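import Literature.Computability.Cryptography.KitaevPhaseEstimationCircuit
import HarnessLib

/-!
# Kitaev's eigenvalue measurement on a superposition: in-place blocks and the mode amplitude

Family `PQC` / topic `Literature/Computability/Cryptography`; a companion of
`KitaevPhaseEstimationCircuit.lean` (Kitaev's circuit `H_controls; V; S³_σ; H_controls` and its
output state `kitaevCircuit_runOn` for a classical block `V` acting OUT OF PLACE,
`|x y 0^m⟩ ↦ |x y (R y)⟩`, on a basis input). The quantum step of van Dam–Seroussi's Gauss-sum
algorithm in the tree (`VanDamSeroussiGaussSums.lean`) measures the register that carries the
REPEATED character state in the Fourier basis of `ℤ/2^κ`, i.e. it measures the eigenvalue of the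
increment `|y⟩ ↦ |y + 1⟩`, whose eigenvectors are the Fourier modes; the register is in
superposition and the block acts IN PLACE (it moves the register content, shifted by the weighted
exponent of the controls, to a fresh register). This file supplies the two facts that situation needs
(Kitaev 1995, §3 Remark 8 and Lemma 8; everything PROVED):

* **`kitaevCircuit_mulVec_superposition`** — linearity: for a block acting as
  `|x y ρ⟩ ↦ |x y (A x y ρ)⟩` on the *good* labels and an input `Σ_{x,ρ} Ψ(x,ρ) |x 0 ρ⟩` supported on
  good labels, the output is `2^{-k} Σ_{x,ρ} Ψ(x,ρ) Σ_{y,y'} (-i)^{#σ∧y} (-1)^{y·y'} |x y' (A x y ρ)⟩`;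
* `modeAmp σ w N f γ = 2^{-k} Σ_y (-i)^{#σ∧y} (-1)^{y·γ} e^{2πi f (Σ_j y_j w_j)/N}` — the control
  amplitude picked up by an eigenvector of eigenphase `f/N` when control `j` applies the `w_j`-th
  power — and **`norm_sq_modeAmp`**: `|modeAmp|² = ∏_j testWeight γ_j σ_j (2π f w_j / N)`
  (independent Hadamard tests; `sum_pi_bool_prod`, `norm_sq_testAmplitude`).

## References

* A. Yu. Kitaev, *Quantum measurements and the Abelian Stabilizer Problem*, arXiv:quant-ph/9511026
  (1995), §3 Remark 8 (single test), Lemma 8 (product rule), Lemma 10 (`U^{[0,r]}`), §5 (the Fourier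
  transform as an eigenvalue measurement of the shift) [Kitaev1995].
* W. van Dam, G. Seroussi, arXiv:quant-ph/0207131 (2002), §4 Thm. 1 [VanDamSeroussi2002].
-/

noncomputable section

namespace Literature.Computability.Cryptography

namespace Kitaev1995

open _root_.Computability Complexity QuantumComplexity Matrix Finset Complex

variable {n k m : ℕ}

/-! ### Kitaev's circuit on a superposition, in-place block -/

/-- **Kitaev's circuit on a superposition with clean controls.** Let the block `V` act as the
classical map `|x y ρ⟩ ↦ |x y (A x y ρ)⟩` on every label with `Good x ρ` (e.g. "the work windows are
clean"), and let the input `Σ_{x,ρ} Ψ(x,ρ) |x 0^k ρ⟩` be supported on good labels. Then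
`(H_controls; V; S³_σ; H_controls)` maps it to
`2^{-k} Σ_{x,ρ} Ψ(x,ρ) Σ_{y,y'} (-i)^{#σ∧y} (-1)^{y·y'} |x y' (A x y ρ)⟩`.
[cite: Kitaev1995, §3 (Remark 8, Lemma 8)] -/
theorem kitaevCircuit_mulVec_superposition (V : QCircuit cliffordT (n + (k + m))) (σ : Fin k → Bool)
    (Good : QReg n → QReg m → Prop) (A : QReg n → QReg k → QReg m → QReg m)
    (hV : ∀ x y ρ, Good x ρ → V.toMatrix 0 *ᵥ basisState (tri x y ρ) = basisState (tri x y (A x y ρ)))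
    (Ψ : QReg n → QReg m → ℂ) (hΨ : ∀ x ρ, Ψ x ρ ≠ 0 → Good x ρ) :
    (kitaevCircuit V σ).toMatrix 0 *ᵥ (∑ x : QReg n, ∑ ρ : QReg m, Ψ x ρ • basisState (tri x (fun _ => false) ρ)) =
      ∑ x : QReg n, ∑ ρ : QReg m, Ψ x ρ • ((invSqrt2 ^ k * invSqrt2 ^ k) •
        ∑ y : QReg k, ∑ y' : QReg k, (sPhase σ y * ySign y y') • basisState (tri x y' (A x y ρ))) := by
  have hsplit : kitaevCircuit V σ =
      ((((⟨hadamardLayer n k m⟩ : QCircuit cliffordT _).append V).append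
        ⟨phaseLayer n k m σ⟩).append ⟨hadamardLayer n k m⟩) := by
    simp [kitaevCircuit, QCircuit.append]
  -- one good basis input
  have hone : ∀ x ρ, Good x ρ →
      (kitaevCircuit V σ).toMatrix 0 *ᵥ basisState (tri x (fun _ => false) ρ) =
        (invSqrt2 ^ k * invSqrt2 ^ k) •
          ∑ y : QReg k, ∑ y' : QReg k, (sPhase σ y * ySign y y') • basisState (tri x y' (A x y ρ)) := by
    intro x ρ hg
    have hy0 : ∀ y : QReg k, ySign (fun _ => false) y = 1 := fun y => by
      rw [ySign]; exact prod_eq_one fun j _ => by simp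
    rw [hsplit, QCircuit.toMatrix_append, QCircuit.toMatrix_append, QCircuit.toMatrix_append,
      ← Matrix.mulVec_mulVec, ← Matrix.mulVec_mulVec, ← Matrix.mulVec_mulVec, hadamardLayer_mulVec_tri,
      Matrix.mulVec_smul, Matrix.mulVec_sum]
    simp_rw [hy0, one_smul, hV x _ ρ hg]
    rw [Matrix.mulVec_smul, Matrix.mulVec_sum]
    simp_rw [phaseLayer_mulVec_tri σ x _ (A x _ ρ)]
    rw [Matrix.mulVec_smul, Matrix.mulVec_sum]
    simp_rw [Matrix.mulVec_smul, hadamardLayer_mulVec_tri, smul_smul, Finset.smul_sum, smul_smul]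
    refine Finset.sum_congr rfl fun y _ => Finset.sum_congr rfl fun y' _ => ?_
    congr 1; ring
  rw [Matrix.mulVec_sum]
  refine Finset.sum_congr rfl fun x _ => ?_
  rw [Matrix.mulVec_sum]
  refine Finset.sum_congr rfl fun ρ _ => ?_
  rw [Matrix.mulVec_smul]
  by_cases h0 : Ψ x ρ = 0
  · rw [h0, zero_smul, zero_smul]
  · rw [hone x ρ (hΨ x ρ h0)]

/-! ### The mode amplitude -/

/-- **The control amplitude of a mode.** `modeAmp σ w N f γ = 2^{-k} Σ_y (-i)^{#σ∧y} (-1)^{y·γ}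
e^{2πi f E(y)/N}`, `E(y) = Σ_j y_j w_j`: the amplitude of the control read-out `γ` when Kitaev's tests,
control `j` applying the `w_j`-th power of the measured permutation, act on an eigenvector of
eigenphase `f/N` (junk: `N = 0` reads as eigenphase `0`, `x/0 = 0`). [cite: Kitaev1995, §3 (Remark 8, Lemma 8, Lemma 10)] -/
def modeAmp (σ : Fin k → Bool) (w : Fin k → ℕ) (N f : ℕ) (γ : QReg k) : ℂ :=
  (1 / 2 : ℂ) ^ k * ∑ y : QReg k, sPhase σ y * ySign y γ *
    cexp (2 * Real.pi * I * ((f : ℂ) * ((∑ j, (y j).toNat * w j : ℕ) : ℂ) / N))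

/-- The phase of a control string splits over the controls. [folklore] -/
theorem exp_weightedExp_eq_prod (w : Fin k → ℕ) (N f : ℕ) (y : QReg k) :
    cexp (2 * Real.pi * I * ((f : ℂ) * ((∑ j, (y j).toNat * w j : ℕ) : ℂ) / N)) =
      ∏ j, cexp (2 * Real.pi * I * ((f : ℂ) * (((y j).toNat * w j : ℕ) : ℂ) / N)) := by
  rw [← Complex.exp_sum]
  congr 1
  push_cast
  rw [mul_sum, sum_div, mul_sum]

/-- **The mode amplitude factorises over the controls**:
`modeAmp = ∏_j (1 + χ_j · e^{2πi f w_j/N})/2` with `χ_j = (-1)^{γ_j} (-i)^{σ_j}`.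
[cite: Kitaev1995, §3 Lemma 8 (measurements with disjoint additional registers multiply)] -/
theorem modeAmp_eq_prod (σ : Fin k → Bool) (w : Fin k → ℕ) (N f : ℕ) (γ : QReg k) :
    modeAmp σ w N f γ = ∏ j, (1 + (if γ j then (-1 : ℂ) else 1) * (if σ j then -I else 1) *
      cexp (2 * Real.pi * I * ((f : ℂ) * (w j : ℂ) / N))) / 2 := by
  classical
  unfold modeAmp
  have hterm : ∀ y : QReg k, sPhase σ y * ySign y γ *
      cexp (2 * Real.pi * I * ((f : ℂ) * ((∑ j, (y j).toNat * w j : ℕ) : ℂ) / N)) =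
      ∏ j, ((if y j then (if γ j then (-1 : ℂ) else 1) * (if σ j then -I else 1) else 1) *
        cexp (2 * Real.pi * I * ((f : ℂ) * (((y j).toNat * w j : ℕ) : ℂ) / N))) := by
    intro y
    rw [sPhase_mul_ySign, exp_weightedExp_eq_prod, ← prod_mul_distrib]
  simp_rw [hterm]
  rw [sum_pi_bool_prod fun j b => (if b then (if γ j then (-1 : ℂ) else 1) * (if σ j then -I else 1) else 1) *
      cexp (2 * Real.pi * I * ((f : ℂ) * ((b.toNat * w j : ℕ) : ℂ) / N)), prod_div_distrib, prod_const, card_univ,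
    Fintype.card_fin, one_div, inv_pow, ← div_eq_inv_mul]
  congr 1
  refine prod_congr rfl fun j _ => ?_
  simp

/-- **The Born weight of a control read-out under a mode is a product of single-test
probabilities**: `|modeAmp σ w N f γ|² = ∏_j testWeight γ_j σ_j (2π f w_j / N)`.
[cite: Kitaev1995, §3 Remark 8 (P(0|φ) = (1 + cos 2πφ)/2) and Lemma 8] -/
theorem norm_sq_modeAmp (σ : Fin k → Bool) (w : Fin k → ℕ) (N f : ℕ) (γ : QReg k) :
    ‖modeAmp σ w N f γ‖ ^ 2 = ∏ j, testWeight (γ j) (σ j) (2 * Real.pi * f * w j / N) := by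
  rw [modeAmp_eq_prod, norm_prod, ← prod_pow]
  refine prod_congr rfl fun j _ => ?_
  rw [testWeight, ← norm_sq_testAmplitude (γ j) (σ j) (2 * Real.pi * f * w j / N)]
  congr 3
  push_cast
  ring

/-- The mode weights are a probability distribution on the read-outs. [cite: Kitaev1995, §3 Lemma 8] -/
theorem sum_norm_sq_modeAmp (σ : Fin k → Bool) (w : Fin k → ℕ) (N f : ℕ) :
    ∑ γ : QReg k, ‖modeAmp σ w N f γ‖ ^ 2 = 1 := by
  classical
  simp_rw [norm_sq_modeAmp]
  rw [sum_pi_bool_prod_real fun j b => testWeight b (σ j) (2 * Real.pi * f * w j / N)]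
  -- the two outcomes of a single test have total probability `1`
  exact prod_eq_one fun j _ => by unfold testWeight; cases σ j <;> simp <;> ring

end Kitaev1995

end Literature.Computability.Cryptography
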